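import Literature.Geometry.ComplexHyperbolic.UnitBallLineField
import HarnessLib

/-!
# A dense subgroup of `U(2,1)` translates any non-zero cotangent field on `𝔹²` off any other

The SINGLE-TRANSLATE form of the tree's line-field theorem `BallModel.exists_wedge_ne_zero'`
(`Literature/Geometry/ComplexHyperbolic/UnitBallLineField.lean`: for a dense subgroup `Δ ≤ U(2,1)` and two
non-zero `Δ`-stable spaces of continuous cotangent fields `𝔹² → ℂ² = T^*𝔹²`, some pair of members has a
non-zero wedge at some point).  For `γ ∈ U(2,1)` and a field `F : 𝔹² → ℂ²` write
`γ^*F := z ↦ J_γ(z)ᵀ · F(γ z)` (the pull-back of the `(1,0)`-form `F₀ dz₀ + F₁ dz₁`; `J_γ(z) = BallModel.Jac γ z`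
is the Jacobian of `z ↦ γ z`).  We prove:

* `translate_mul` — the cocycle rule `(εγ)^*F = γ^*(ε^*F)` (`BallModel.Jac_mul`), `translate_one`;
* `continuous_Jac_right`, `continuous_translate` — `γ^*F` is continuous for continuous `F`;
* `wedge_translate_translate` — `(γ^*F ∧ δ^*G)(z) = det J_δ(z) · ((γδ⁻¹)^*F ∧ G)(δ z)` (`wedge_mulVec`);
* **`exists_translate_wedge_ne_zero`** — for `Δ ≤ U(2,1)` DENSE and `F, G : 𝔹² → ℂ²` continuous and not
  identically zero there are `γ ∈ Δ` and `z ∈ 𝔹²` with `(γ^*F)(z) ∧ G(z) ≠ 0`.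
  Proof: the `ℂ`-spans of the `Δ`-translates of `F`, resp. `G`, are non-zero `Δ`-stable spaces of continuous
  fields (stability for the transpose-inverse Jacobian cocycle `BallModel.A`, by `translate_mul`), so by
  `exists_wedge_ne_zero'` two members have a non-zero wedge somewhere; by bilinearity two TRANSLATES `γ^*F`,
  `δ^*G` do, and `(γ^*F ∧ δ^*G)(z) = det J_δ(z) · ((γδ⁻¹)^*F ∧ G)(δz)`.

This is the shape in which the theorem is consumed by «Hecke-translate wedge» statements on compact ball
quotients (two non-zero holomorphic one-forms `a, a′` on `Γ\𝔹²` acquire a non-zero wedge `T_γ^*a ∧ π^*a′`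
after ONE rational Hecke translation; Clozel, J. reine angew. Math. 444 (1993); Venkataramana, Compositio
Math. 125 (2001) Thm. 8, holomorphic case), with `Δ` the image of the rational points of the unitary group
(dense: `RealApproximation.dense_range_toFrameUnitary`).  All statements are proved from the tree; no
definitions (the translate is written out), no records.

References: PerL v5 Prop. 4.3 (density / `SU(2)`-transitivity skeleton, as in `UnitBallLineField`);
T. N. Venkataramana, Compositio Math. 125 (2001), Thm. 8 and Remark; A. Borel, *Automorphic forms on
`SL₂(ℝ)`* (1997) §5.14 (pull-back of vector-valued forms ↔ automorphy factors); L. Clozel, J. reine angew.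
Math. 444 (1993) 1–15 (holomorphic case).  Private helpers are elementary linear algebra / topology.

## Provenance

Hodge-ladder cell pub-hodgecm2 (COR-CM, stage 2), seat b10 gen 16: step (a) of the elementary proof of the
displayed B01 leaf `HeckeWedge10` on the model universe (CLAIM B01-H-PROVE).
-/

set_option autoImplicit false

noncomputable section

namespace Literature.Geometry.ComplexHyperbolic

namespace BallModel

open Matrix Literature.Topology.Algebra

/-! ### The translate `γ^*F = z ↦ J_γ(z)ᵀ F(γ z)` : cocycle, continuity, wedge -/

/-- `1^*F = F` (the automorphy factor of the identity is `1`). [cite: Borel1997, §5.14] -/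
theorem translate_one (F : Ball → (Fin 2 → ℂ)) :
    (fun z : Ball => (Jac 1 z)ᵀ *ᵥ F ((1 : U21) • z)) = F := by
  funext z
  rw [Jac_one, transpose_one, one_mulVec, one_smul]

/-- **Cocycle rule** `((εγ)^*F)(z) = J_γ(z)ᵀ · (ε^*F)(γ z)` (`J_{εγ}(z) = J_ε(γz) J_γ(z)`: the automorphy
factor is a cocycle). [cite: Borel1997, §5.14] -/
theorem translate_mul (F : Ball → (Fin 2 → ℂ)) (ε γ : U21) (z : Ball) :
    (Jac (ε * γ) z)ᵀ *ᵥ F ((ε * γ) • z) = (Jac γ z)ᵀ *ᵥ ((Jac ε (γ • z))ᵀ *ᵥ F (ε • γ • z)) := by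
  rw [Jac_mul, transpose_mul, ← mulVec_mulVec, mul_smul]

/-- `z ↦ (γ·(z,1))_k` is continuous. [folklore] -/
private theorem continuous_W3_right (g : U21) (k : Fin 3) : Continuous fun z : Ball => W3 g z k :=
  (continuous_W3 k).comp (continuous_const.prodMk continuous_id)

/-- `z ↦ J_γ(z)` is continuous on the ball (the automorphy factor is continuous, indeed holomorphic, in `z`).
[cite: Borel1997, §5.14] -/
theorem continuous_Jac_right (g : U21) : Continuous fun z : Ball => Jac g z := by
  refine continuous_matrix fun i j => ?_
  simp only [Jac, Matrix.of_apply]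
  exact ((continuous_const.mul (continuous_W3_right g 2)).sub
    ((continuous_W3_right g _).mul continuous_const)).div
    ((continuous_W3_right g 2).pow 2) fun z => pow_ne_zero _ (W3_2_ne_zero g z)

/-- `γ^*F` is continuous for continuous `F`. [cite: Borel1997, §5.14] -/
theorem continuous_translate {F : Ball → (Fin 2 → ℂ)} (hF : Continuous F) (g : U21) :
    Continuous fun z : Ball => (Jac g z)ᵀ *ᵥ F (g • z) :=
  (continuous_Jac_right g).matrix_transpose.matrix_mulVec (hF.comp (continuous_const_smul g))

/-- **Wedge of two translates**: `(γ^*F ∧ δ^*G)(z) = det J_δ(z) · ((γδ⁻¹)^*F ∧ G)(δ z)` (pull-back of a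
`2`-form multiplies by the Jacobian determinant, the canonical automorphy factor). [cite: Borel1997, §5.14] -/
theorem wedge_translate_translate (F G : Ball → (Fin 2 → ℂ)) (γ δ : U21) (z : Ball) :
    wedge ((Jac γ z)ᵀ *ᵥ F (γ • z)) ((Jac δ z)ᵀ *ᵥ G (δ • z)) =
      (Jac δ z).det * wedge ((Jac (γ * δ⁻¹) (δ • z))ᵀ *ᵥ F ((γ * δ⁻¹) • δ • z)) (G (δ • z)) := by
  have h : (Jac γ z)ᵀ *ᵥ F (γ • z) =
      (Jac δ z)ᵀ *ᵥ ((Jac (γ * δ⁻¹) (δ • z))ᵀ *ᵥ F ((γ * δ⁻¹) • δ • z)) := by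
    rw [← translate_mul, inv_mul_cancel_right]
  rw [h, wedge_mulVec, det_transpose]

/-! ### Bilinearity of the wedge in the fields -/

/-- For a fixed field `v`, the fields `u` with `u(z) ∧ v(z) = 0` everywhere form a subspace. [folklore] -/
private theorem span_le_wedge_left_eq_zero {s : Set (Ball → (Fin 2 → ℂ))} {v : Ball → (Fin 2 → ℂ)}
    (h : ∀ u ∈ s, ∀ z, wedge (u z) (v z) = 0) {u : Ball → (Fin 2 → ℂ)} (hu : u ∈ Submodule.span ℂ s) (z : Ball) :
    wedge (u z) (v z) = 0 := by
  induction hu using Submodule.span_induction generalizing z with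
  | mem x hx => exact h x hx z
  | zero => simp [wedge]
  | add x y _ _ hx hy =>
    have e : wedge ((x + y) z) (v z) = wedge (x z) (v z) + wedge (y z) (v z) := by
      simp only [wedge, Pi.add_apply]; ring
    rw [e, hx z, hy z, add_zero]
  | smul c x _ hx =>
    have e : wedge ((c • x) z) (v z) = c * wedge (x z) (v z) := by
      simp only [wedge, Pi.smul_apply, smul_eq_mul]; ring
    rw [e, hx z, mul_zero]

/-- For a fixed field `u`, the fields `v` with `u(z) ∧ v(z) = 0` everywhere form a subspace. [folklore] -/
private theorem span_le_wedge_right_eq_zero {s : Set (Ball → (Fin 2 → ℂ))} {u : Ball → (Fin 2 → ℂ)}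
    (h : ∀ v ∈ s, ∀ z, wedge (u z) (v z) = 0) {v : Ball → (Fin 2 → ℂ)} (hv : v ∈ Submodule.span ℂ s) (z : Ball) :
    wedge (u z) (v z) = 0 := by
  induction hv using Submodule.span_induction generalizing z with
  | mem x hx => exact h x hx z
  | zero => simp [wedge]
  | add x y _ _ hx hy =>
    have e : wedge (u z) ((x + y) z) = wedge (u z) (x z) + wedge (u z) (y z) := by
      simp only [wedge, Pi.add_apply]; ring
    rw [e, hx z, hy z, add_zero]
  | smul c x _ hx =>
    have e : wedge (u z) ((c • x) z) = c * wedge (u z) (x z) := by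
      simp only [wedge, Pi.smul_apply, smul_eq_mul]; ring
    rw [e, hx z, mul_zero]

/-! ### The span of the `Δ`-translates of a field -/

section Span

variable (Δ : Subgroup U21)

/-- Members of the span of the translates of a continuous field are continuous. [folklore] -/
private theorem continuous_of_mem_span_translate {F : Ball → (Fin 2 → ℂ)} (hF : Continuous F)
    {u : Ball → (Fin 2 → ℂ)}
    (hu : u ∈ Submodule.span ℂ (Set.range fun γ : Δ => fun z : Ball => (Jac (γ : U21) z)ᵀ *ᵥ F ((γ : U21) • z))) :
    Continuous u := by
  induction hu using Submodule.span_induction with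
  | mem x hx =>
    obtain ⟨γ, rfl⟩ := hx
    exact continuous_translate hF _
  | zero => exact continuous_const
  | add x y _ _ hx hy => exact hx.add hy
  | smul c x _ hx => exact hx.const_smul c

/-- **The span of the `Δ`-translates of `F` is `Δ`-stable** for the transpose-inverse Jacobian cocycle `A`
(`u = ε^*F ⇒ u = γ^*((εγ⁻¹)^*F)`, i.e. `((εγ⁻¹)^*F)(γz) = A γ z (u z)`) — the translation-stable spaces of
PerL v5 Prop. 4.3 / of the tree's `UnitBallLineField`. [cite: Borel1997, §5.14] -/
theorem stableUnder_span_translate (F : Ball → (Fin 2 → ℂ)) :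
    DenseSubgroup.StableUnder Δ A
      (Submodule.span ℂ (Set.range fun γ : Δ => fun z : Ball => (Jac (γ : U21) z)ᵀ *ᵥ F ((γ : U21) • z))) := by
  intro γ hγ u hu
  induction hu using Submodule.span_induction with
  | mem x hx =>
    obtain ⟨ε, rfl⟩ := hx
    refine ⟨fun z => (Jac ((ε : U21) * γ⁻¹) z)ᵀ *ᵥ F (((ε : U21) * γ⁻¹) • z),
      Submodule.subset_span ⟨⟨(ε : U21) * γ⁻¹, Δ.mul_mem ε.2 (Δ.inv_mem hγ)⟩, rfl⟩, fun z => ?_⟩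
    -- `(εγ⁻¹)^*F (γ z) = coT γ z · (ε^*F)(z)` from `ε = (εγ⁻¹) γ`
    have hε : (Jac (ε : U21) z)ᵀ *ᵥ F ((ε : U21) • z) =
        (Jac γ z)ᵀ *ᵥ ((Jac ((ε : U21) * γ⁻¹) (γ • z))ᵀ *ᵥ F (((ε : U21) * γ⁻¹) • γ • z)) := by
      rw [← translate_mul, inv_mul_cancel_right]
    simp only [A_apply]
    rw [hε, mulVec_mulVec, coT_mul_transpose_Jac, one_mulVec]
  | zero => exact ⟨0, Submodule.zero_mem _, fun z => by simp⟩
  | add x y _ _ hx hy =>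
    obtain ⟨x', hx', hxe⟩ := hx
    obtain ⟨y', hy', hye⟩ := hy
    exact ⟨x' + y', Submodule.add_mem _ hx' hy', fun z => by
      rw [Pi.add_apply, Pi.add_apply, map_add, hxe z, hye z]⟩
  | smul c x _ hx =>
    obtain ⟨x', hx', hxe⟩ := hx
    exact ⟨c • x', Submodule.smul_mem _ c hx', fun z => by
      rw [Pi.smul_apply, Pi.smul_apply, map_smul, hxe z]⟩

/-- `F` itself (`= 1^*F`) lies in the span of its `Δ`-translates. [folklore] -/
private theorem mem_span_translate (F : Ball → (Fin 2 → ℂ)) :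
    F ∈ Submodule.span ℂ (Set.range fun γ : Δ => fun z : Ball => (Jac (γ : U21) z)ᵀ *ᵥ F ((γ : U21) • z)) := by
  refine Submodule.subset_span ⟨1, ?_⟩
  change (fun z : Ball => (Jac (1 : U21) z)ᵀ *ᵥ F ((1 : U21) • z)) = F
  exact translate_one F

end Span

/-! ### The single-translate wedge theorem -/

/-- **A dense subgroup translates any non-zero cotangent field off any other.**  For `Δ ≤ U(2,1)` dense and
`F, G : 𝔹² → ℂ²` continuous and non-zero there are `γ ∈ Δ` and `z ∈ 𝔹²` with `(γ^*F)(z) ∧ G(z) ≠ 0`, where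
`(γ^*F)(z) = J_γ(z)ᵀ F(γz)`.  (From `exists_wedge_ne_zero'` applied to the spans of the `Δ`-translates of `F`
and of `G`; bilinearity of the wedge and `wedge_translate_translate` reduce a non-zero wedge of two members to
one of a single translate of `F` against `G`.)  This is the universal-cover form of the HOLOMORPHIC CASE of
Venkataramana's Theorem 8 («`a, a′ ≠ 0` of degrees `k + k′ ≤ n` ⇒ `∃ g ∈ G_f, g(a) ∧ a′ ≠ 0`», here `n = 2`,
`k = k′ = 1`; proved there via Clozel–Venkataramana, and in the holomorphic case by Clozel 1993) with the
finite-adelic `g ∈ G_f` replaced by an element of ANY dense subgroup of `U(2,1)` acting on lifted cotangent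
fields — the mechanism of PerL v5 Prop. 4.3. [cite: Venkataramana2001, Thm. 8 and Remark (p. 229)]
[cite: Clozel1993ProduitsII, Introduction] -/
theorem exists_translate_wedge_ne_zero (Δ : Subgroup U21) (hΔ : Dense (Δ : Set U21))
    {F G : Ball → (Fin 2 → ℂ)} (hF : Continuous F) (hG : Continuous G) (hF0 : F ≠ 0) (hG0 : G ≠ 0) :
    ∃ γ ∈ Δ, ∃ z : Ball, wedge ((Jac γ z)ᵀ *ᵥ F (γ • z)) (G z) ≠ 0 := by
  by_contra hcon
  have hcon' : ∀ γ ∈ Δ, ∀ z : Ball, wedge ((Jac γ z)ᵀ *ᵥ F (γ • z)) (G z) = 0 :=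
    fun γ hγ z => Classical.byContradiction fun h => hcon ⟨γ, hγ, z, h⟩
  -- the two stable spaces
  set SF := Submodule.span ℂ (Set.range fun γ : Δ => fun z : Ball => (Jac (γ : U21) z)ᵀ *ᵥ F ((γ : U21) • z))
    with hSF
  set SG := Submodule.span ℂ (Set.range fun γ : Δ => fun z : Ball => (Jac (γ : U21) z)ᵀ *ᵥ G ((γ : U21) • z))
    with hSG
  have hF' : SF ≠ ⊥ := (Submodule.ne_bot_iff _).2 ⟨F, mem_span_translate Δ F, hF0⟩
  have hG' : SG ≠ ⊥ := (Submodule.ne_bot_iff _).2 ⟨G, mem_span_translate Δ G, hG0⟩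
  -- any two translates have zero wedge everywhere
  have h2 : ∀ γ ∈ Δ, ∀ δ ∈ Δ, ∀ z : Ball,
      wedge ((Jac γ z)ᵀ *ᵥ F (γ • z)) ((Jac δ z)ᵀ *ᵥ G (δ • z)) = 0 := by
    intro γ hγ δ hδ z
    rw [wedge_translate_translate, hcon' (γ * δ⁻¹) (Δ.mul_mem hγ (Δ.inv_mem hδ)) (δ • z), mul_zero]
  -- hence any two members of the spans
  have h3 : ∀ u ∈ SF, ∀ v ∈ SG, ∀ z : Ball, wedge (u z) (v z) = 0 := by
    intro u hu v hv z
    refine span_le_wedge_left_eq_zero (v := v) (fun u' hu' z' => ?_) hu z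
    obtain ⟨γ, rfl⟩ := hu'
    change wedge ((Jac (γ : U21) z')ᵀ *ᵥ F ((γ : U21) • z')) (v z') = 0
    exact span_le_wedge_right_eq_zero (u := fun w : Ball => (Jac (γ : U21) w)ᵀ *ᵥ F ((γ : U21) • w))
      (fun v' hv' z'' => by
        obtain ⟨δ, rfl⟩ := hv'
        exact h2 γ γ.2 δ δ.2 z'') hv z'
  obtain ⟨u, hu, v, hv, z, hz⟩ := exists_wedge_ne_zero' Δ hΔ SF SG
    (fun u hu => continuous_of_mem_span_translate Δ hF hu) (fun v hv => continuous_of_mem_span_translate Δ hG hv)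
    (stableUnder_span_translate Δ F) (stableUnder_span_translate Δ G) hF' hG'
  exact hz (h3 u hu v hv z)

/-- The same with the conclusion read as linear independence of the two covectors.
[cite: Venkataramana2001, Thm. 8 and Remark (p. 229)] -/
theorem exists_translate_linearIndependent (Δ : Subgroup U21) (hΔ : Dense (Δ : Set U21))
    {F G : Ball → (Fin 2 → ℂ)} (hF : Continuous F) (hG : Continuous G) (hF0 : F ≠ 0) (hG0 : G ≠ 0) :
    ∃ γ ∈ Δ, ∃ z : Ball, LinearIndependent ℂ ![(Jac γ z)ᵀ *ᵥ F (γ • z), G z] := by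
  obtain ⟨γ, hγ, z, hz⟩ := exists_translate_wedge_ne_zero Δ hΔ hF hG hF0 hG0
  exact ⟨γ, hγ, z, (linearIndependent_pair_iff_wedge_ne_zero _ _).2 hz⟩

end BallModel

end Literature.Geometry.ComplexHyperbolic

end
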